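import Literature.Analysis.ODE.JostGreen

/-!
# Route MarginalStabilityChain · BurgersLayerLowRe — the Green operator of `α² − ∂²` on the line

Helper file (supports stmt-AnomalousDissipation-3010, `BurgersLayerLowRe`). For `α > 0` and a bounded
continuous `φ : ℝ → ℂ` the Green potential

`T φ (y) = (2α)⁻¹ ∫ e^{−α|y−s|} φ(s) ds`

is the unique bounded solution of `g'' = α² g − φ`. This file: the kernel integral is absolutely
convergent; its split form in terms of the tail primitive `Literature.Analysis.ODE.jostJ₂`
(`T φ (y) = (2α)⁻¹ (e^{−αy} J₂(φ̃)(−y) + e^{αy} J₂(φ)(y))`, `φ̃(s) = φ(−s)`); first and second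
derivatives (`(Tφ)'' = α² Tφ − φ`); the bounds `‖Tφ‖ ≤ M/α²`, `‖(Tφ)'‖ ≤ M/α` (`M = sup‖φ‖`) and
`‖Tφ(y)‖ ≤ (2α)⁻¹ ‖φ‖_{L¹}`; oddness is preserved. Everything is elementary calculus (folklore; e.g.
Coddington–Levinson Ch. 3, variation of constants). No definitions: the operator is always written out,
downstream files characterise it by the hypothesis `T = fun y => (2α)⁻¹ ∫ e^{−α|y−s|} φ s`.
-/

noncomputable section

open MeasureTheory Set Filter Topology
open scoped Real

namespace Summit.AnomalousDissipation.AnomalousDissipation.Theorems.MarginalStabilityChainBurgersLayerLowRe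

-- the summit and its single sub-problem share the name `AnomalousDissipation` (tree layout D-0017)
set_option linter.dupNamespace false

open Literature.Analysis.ODE

variable {α : ℝ} {φ : ℝ → ℂ} {M : ℝ}

/-! ### The kernel -/

/-- `0 ≤ M` as soon as `‖φ s‖ ≤ M` for some `s`. [folklore] -/
theorem bound_nonneg (hM : ∀ s, ‖φ s‖ ≤ M) : 0 ≤ M := (norm_nonneg _).trans (hM 0)

/-- The kernel `e^{−α|y−s|}` has modulus `≤ 1` for `α ≥ 0`. [folklore] -/
theorem kernel_le_one (hα : 0 ≤ α) (y s : ℝ) : Real.exp (-(α * |y - s|)) ≤ 1 := by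
  rw [Real.exp_le_one_iff, neg_nonpos]; positivity

/-- Norm of the complexified kernel. [folklore] -/
theorem norm_kernel (y s : ℝ) : ‖((Real.exp (-(α * |y - s|)) : ℝ) : ℂ)‖ = Real.exp (-(α * |y - s|)) := by
  rw [Complex.norm_real, Real.norm_of_nonneg (Real.exp_pos _).le]

/-- The kernel `s ↦ e^{−α|y−s|}` is integrable on the line (`α > 0`). [folklore] -/
theorem integrable_kernel (hα : 0 < α) (y : ℝ) : Integrable fun s : ℝ => Real.exp (-(α * |y - s|)) := by
  have h1 : IntegrableOn (fun s : ℝ => Real.exp (-(α * |y - s|))) (Iic y) := by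
    refine IntegrableOn.congr_fun ((integrableOn_exp_mul_Iic hα y).mul_const (Real.exp (-(α * y))))
      (fun s hs => ?_) measurableSet_Iic
    show Real.exp (α * s) * Real.exp (-(α * y)) = Real.exp (-(α * |y - s|))
    rw [abs_of_nonneg (sub_nonneg.2 hs), ← Real.exp_add]; congr 1; ring
  have h2 : IntegrableOn (fun s : ℝ => Real.exp (-(α * |y - s|))) (Ioi y) := by
    refine IntegrableOn.congr_fun ((integrableOn_exp_mul_Ioi (neg_lt_zero.2 hα) y).mul_const (Real.exp (α * y)))
      (fun s hs => ?_) measurableSet_Ioi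
    show Real.exp (-α * s) * Real.exp (α * y) = Real.exp (-(α * |y - s|))
    rw [abs_of_neg (sub_neg.2 hs), ← Real.exp_add]; congr 1; ring
  have h := h1.union h2
  rwa [Iic_union_Ioi, integrableOn_univ] at h

/-- The integrand `e^{−α|y−s|} φ(s)` is integrable for bounded continuous `φ`. [folklore] -/
theorem integrable_kernel_mul (hα : 0 < α) (hφ : Continuous φ) (hM : ∀ s, ‖φ s‖ ≤ M) (y : ℝ) :
    Integrable fun s : ℝ => ((Real.exp (-(α * |y - s|)) : ℝ) : ℂ) * φ s := by
  exact (integrable_kernel hα y).ofReal.mul_bdd hφ.aestronglyMeasurable (Eventually.of_forall hM)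

/-! ### The reflected function and the split form -/

/-- The bounded continuous function attached to `φ`. [folklore] -/
theorem bcf_apply (hφ : Continuous φ) (hM : ∀ s, ‖φ s‖ ≤ M) (s : ℝ) : BCF.mk φ hφ M hM s = φ s := rfl

/-- Continuity of the reflection `s ↦ φ(−s)`. [folklore] -/
theorem continuous_refl (hφ : Continuous φ) : Continuous fun s : ℝ => φ (-s) := hφ.comp continuous_neg

/-- The bound of the reflection. [folklore] -/
theorem bound_refl (hM : ∀ s, ‖φ s‖ ≤ M) : ∀ s : ℝ, ‖φ (-s)‖ ≤ M := fun s => hM (-s)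

/-- Left piece: `∫_{s ≤ y} e^{−α|y−s|} φ(s) ds = e^{−αy} J₂(φ̃)(−y)`. [folklore] -/
theorem integral_Iic_kernel_mul (hφ : Continuous φ) (hM : ∀ s, ‖φ s‖ ≤ M) (y : ℝ) :
    ∫ s in Iic y, ((Real.exp (-(α * |y - s|)) : ℝ) : ℂ) * φ s =
      Complex.exp (-(α * y)) * jostJ₂ (α : ℂ) 0 (BCF.mk (fun s => φ (-s)) (continuous_refl hφ) M (bound_refl hM)) (-y) := by
  have hsub := integral_comp_neg_Ioi (-y) (fun s : ℝ => ((Real.exp (-(α * |y - s|)) : ℝ) : ℂ) * φ s)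
  rw [neg_neg] at hsub
  rw [← hsub, jostJ₂, ← integral_const_mul]
  refine setIntegral_congr_fun measurableSet_Ioi (fun u hu => ?_)
  simp only [BCF.mk_apply, sub_neg_eq_add, sub_zero]
  have hyu : 0 < y + u := by rw [mem_Ioi] at hu; linarith
  rw [abs_of_pos hyu, Complex.ofReal_exp, ← mul_assoc, ← Complex.exp_add]
  congr 1; push_cast; ring

/-- Right piece: `∫_{s > y} e^{−α|y−s|} φ(s) ds = e^{αy} J₂(φ)(y)`. [folklore] -/
theorem integral_Ioi_kernel_mul (hφ : Continuous φ) (hM : ∀ s, ‖φ s‖ ≤ M) (y : ℝ) :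
    ∫ s in Ioi y, ((Real.exp (-(α * |y - s|)) : ℝ) : ℂ) * φ s =
      Complex.exp (α * y) * jostJ₂ (α : ℂ) 0 (BCF.mk φ hφ M hM) y := by
  rw [jostJ₂, ← integral_const_mul]
  refine setIntegral_congr_fun measurableSet_Ioi (fun s hs => ?_)
  simp only [BCF.mk_apply, sub_zero]
  rw [abs_of_neg (sub_neg.2 hs), ← mul_assoc, Complex.ofReal_exp, ← Complex.exp_add]
  congr 1; push_cast; ring

/-- **Split form** of the Green potential:
`∫ e^{−α|y−s|} φ(s) ds = e^{−αy} J₂(φ̃)(−y) + e^{αy} J₂(φ)(y)`. [folklore] -/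
theorem integral_kernel_mul_eq_split (hα : 0 < α) (hφ : Continuous φ) (hM : ∀ s, ‖φ s‖ ≤ M) (y : ℝ) :
    ∫ s, ((Real.exp (-(α * |y - s|)) : ℝ) : ℂ) * φ s =
      Complex.exp (-(α * y)) * jostJ₂ (α : ℂ) 0 (BCF.mk (fun s => φ (-s)) (continuous_refl hφ) M (bound_refl hM)) (-y) +
        Complex.exp (α * y) * jostJ₂ (α : ℂ) 0 (BCF.mk φ hφ M hM) y := by
  rw [← integral_add_compl (measurableSet_Iic : MeasurableSet (Iic y)) (integrable_kernel_mul hα hφ hM y),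
    compl_Iic, integral_Iic_kernel_mul hφ hM, integral_Ioi_kernel_mul hφ hM]


/-! ### Derivatives of the split form -/

/-- `d/dy e^{−αy} = −α e^{−αy}` (complex-valued, real variable). [folklore] -/
theorem hasDerivAt_cexp_neg (α y : ℝ) :
    HasDerivAt (fun u : ℝ => Complex.exp (-(α * u))) (-(α : ℂ) * Complex.exp (-(α * y))) y := by
  have h := (((hasDerivAt_id y).ofReal_comp.const_mul (α : ℂ)).neg).cexp
  convert h using 1 <;> simp [mul_comm]

/-- `d/dy e^{αy} = α e^{αy}` (complex-valued, real variable). [folklore] -/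
theorem hasDerivAt_cexp_pos (α y : ℝ) :
    HasDerivAt (fun u : ℝ => Complex.exp (α * u)) ((α : ℂ) * Complex.exp (α * y)) y := by
  have h := ((hasDerivAt_id y).ofReal_comp.const_mul (α : ℂ)).cexp
  convert h using 1 <;> simp [mul_comm]

/-- `e^{−αy} e^{αy} = 1`. [folklore] -/
theorem cexp_neg_mul_cexp (α y : ℝ) : Complex.exp (-(α * y)) * Complex.exp (α * y) = 1 := by
  rw [← Complex.exp_add]; simp

/-- **First derivative of the split form**: the integrand contributions cancel and
`d/dy [e^{−αy} J₂(φ̃)(−y) + e^{αy} J₂(φ)(y)] = α [−e^{−αy} J₂(φ̃)(−y) + e^{αy} J₂(φ)(y)]`. [folklore] -/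
theorem hasDerivAt_split (hα : 0 < α) (hφ : Continuous φ) (hM : ∀ s, ‖φ s‖ ≤ M) (y : ℝ) :
    HasDerivAt (fun u : ℝ =>
        Complex.exp (-(α * u)) * jostJ₂ (α : ℂ) 0 (BCF.mk (fun s => φ (-s)) (continuous_refl hφ) M (bound_refl hM)) (-u) +
          Complex.exp (α * u) * jostJ₂ (α : ℂ) 0 (BCF.mk φ hφ M hM) u)
      ((α : ℂ) * (-(Complex.exp (-(α * y)) *
            jostJ₂ (α : ℂ) 0 (BCF.mk (fun s => φ (-s)) (continuous_refl hφ) M (bound_refl hM)) (-y)) +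
          Complex.exp (α * y) * jostJ₂ (α : ℂ) 0 (BCF.mk φ hφ M hM) y)) y := by
  have hre : 0 < ((α : ℂ)).re := by simpa using hα
  set ψ := BCF.mk (fun s => φ (-s)) (continuous_refl hφ) M (bound_refl hM) with hψ
  set χ := BCF.mk φ hφ M hM with hχ
  have hA : HasDerivAt (fun u : ℝ => jostJ₂ (α : ℂ) 0 ψ (-u))
      (-(Complex.exp (-((α : ℂ) * (((-y) - 0 : ℝ) : ℂ))) * ψ (-y)) * (-1)) y :=
    (hasDerivAt_jostJ₂ hre 0 ψ (-y)).scomp y (hasDerivAt_neg y) |>.congr_deriv (by simp)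
  have hB := hasDerivAt_jostJ₂ hre 0 χ y
  have h := ((hasDerivAt_cexp_neg α y).mul hA).add ((hasDerivAt_cexp_pos α y).mul hB)
  refine h.congr_deriv ?_
  have hψy : ψ (-y) = φ y := by simp [hψ]
  have hχy : χ y = φ y := by simp [hχ]
  have e1 : Complex.exp (-((α : ℂ) * (((-y) - 0 : ℝ) : ℂ))) = Complex.exp (α * y) := by
    congr 1; push_cast; ring
  have e2 : Complex.exp (-((α : ℂ) * ((y - 0 : ℝ) : ℂ))) = Complex.exp (-(α * y)) := by
    congr 1; push_cast; ring
  rw [hψy, hχy, e1, e2]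
  linear_combination (φ y) * cexp_neg_mul_cexp α y - (φ y) * cexp_neg_mul_cexp α y

/-- **Second derivative of the split form**:
`d/dy [−e^{−αy} J₂(φ̃)(−y) + e^{αy} J₂(φ)(y)] = α [e^{−αy} J₂(φ̃)(−y) + e^{αy} J₂(φ)(y)] − 2 φ(y)`. [folklore] -/
theorem hasDerivAt_split' (hα : 0 < α) (hφ : Continuous φ) (hM : ∀ s, ‖φ s‖ ≤ M) (y : ℝ) :
    HasDerivAt (fun u : ℝ =>
        -(Complex.exp (-(α * u)) * jostJ₂ (α : ℂ) 0 (BCF.mk (fun s => φ (-s)) (continuous_refl hφ) M (bound_refl hM)) (-u)) +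
          Complex.exp (α * u) * jostJ₂ (α : ℂ) 0 (BCF.mk φ hφ M hM) u)
      ((α : ℂ) * (Complex.exp (-(α * y)) *
            jostJ₂ (α : ℂ) 0 (BCF.mk (fun s => φ (-s)) (continuous_refl hφ) M (bound_refl hM)) (-y) +
          Complex.exp (α * y) * jostJ₂ (α : ℂ) 0 (BCF.mk φ hφ M hM) y) - 2 * φ y) y := by
  have hre : 0 < ((α : ℂ)).re := by simpa using hα
  set ψ := BCF.mk (fun s => φ (-s)) (continuous_refl hφ) M (bound_refl hM) with hψ
  set χ := BCF.mk φ hφ M hM with hχ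
  have hA : HasDerivAt (fun u : ℝ => jostJ₂ (α : ℂ) 0 ψ (-u))
      (-(Complex.exp (-((α : ℂ) * (((-y) - 0 : ℝ) : ℂ))) * ψ (-y)) * (-1)) y :=
    (hasDerivAt_jostJ₂ hre 0 ψ (-y)).scomp y (hasDerivAt_neg y) |>.congr_deriv (by simp)
  have hB := hasDerivAt_jostJ₂ hre 0 χ y
  have h := ((hasDerivAt_cexp_neg α y).mul hA).neg.add ((hasDerivAt_cexp_pos α y).mul hB)
  refine h.congr_deriv ?_
  have hψy : ψ (-y) = φ y := by simp [hψ]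
  have hχy : χ y = φ y := by simp [hχ]
  have e1 : Complex.exp (-((α : ℂ) * (((-y) - 0 : ℝ) : ℂ))) = Complex.exp (α * y) := by
    congr 1; push_cast; ring
  have e2 : Complex.exp (-((α : ℂ) * ((y - 0 : ℝ) : ℂ))) = Complex.exp (-(α * y)) := by
    congr 1; push_cast; ring
  rw [hψy, hχy, e1, e2]
  linear_combination (-(φ y)) * cexp_neg_mul_cexp α y - (φ y) * cexp_neg_mul_cexp α y

/-! ### The Green potential: derivatives and bounds -/

variable {T : ℝ → ℂ}

/-- **The Green potential solves `g'' = α² g − φ`**: with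
`T = (2α)⁻¹ ∫ e^{−α|y−s|} φ(s) ds` there is `T'` with `T' = dT/dy`, `dT'/dy = α² T − φ`, and
`‖T'‖ ≤ M/α`. [folklore] -/
theorem green_hasDerivAt (hα : 0 < α) (hφ : Continuous φ) (hM : ∀ s, ‖φ s‖ ≤ M)
    (hT : T = fun y => (2 * (α : ℂ))⁻¹ * ∫ s, ((Real.exp (-(α * |y - s|)) : ℝ) : ℂ) * φ s) :
    ∃ T' : ℝ → ℂ, (∀ y, HasDerivAt T (T' y) y) ∧ (∀ y, HasDerivAt T' ((α : ℂ) ^ 2 * T y - φ y) y) ∧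
      ∀ y, ‖T' y‖ ≤ M / α := by
  have hre : 0 < ((α : ℂ)).re := by simpa using hα
  have hα0 : (α : ℂ) ≠ 0 := by exact_mod_cast hα.ne'
  set ψ := BCF.mk (fun s => φ (-s)) (continuous_refl hφ) M (bound_refl hM) with hψ
  set χ := BCF.mk φ hφ M hM with hχ
  have hTs : T = fun y : ℝ => (2 * (α : ℂ))⁻¹ * (Complex.exp (-(α * y)) * jostJ₂ (α : ℂ) 0 ψ (-y) +
      Complex.exp (α * y) * jostJ₂ (α : ℂ) 0 χ y) := by
    rw [hT]; funext y; rw [integral_kernel_mul_eq_split hα hφ hM]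
  refine ⟨fun y : ℝ => (1 / 2 : ℂ) * (-(Complex.exp (-(α * y)) * jostJ₂ (α : ℂ) 0 ψ (-y)) +
      Complex.exp (α * y) * jostJ₂ (α : ℂ) 0 χ y), fun y => ?_, fun y => ?_, fun y => ?_⟩
  · rw [hTs]
    refine ((hasDerivAt_split hα hφ hM y).const_mul ((2 * (α : ℂ))⁻¹)).congr_deriv ?_
    field_simp
    rfl
  · refine ((hasDerivAt_split' hα hφ hM y).const_mul (1 / 2 : ℂ)).congr_deriv ?_
    rw [hTs]
    field_simp
    ring
  · have h1 : ‖Complex.exp (-(α * y)) * jostJ₂ (α : ℂ) 0 ψ (-y)‖ ≤ M / α := by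
      have h := norm_exp_mul_jostJ₂_le hre 0 ψ (-y)
      have e1 : Complex.exp ((α : ℂ) * (((-y) - 0 : ℝ) : ℂ)) = Complex.exp (-(α * y)) := by
        congr 1; push_cast; ring
      rw [e1] at h
      refine h.trans ?_
      simp only [Complex.ofReal_re]
      gcongr
      exact BCF.norm_mk_le (bound_nonneg hM) _
    have h2 : ‖Complex.exp (α * y) * jostJ₂ (α : ℂ) 0 χ y‖ ≤ M / α := by
      have h := norm_exp_mul_jostJ₂_le hre 0 χ y
      have e1 : Complex.exp ((α : ℂ) * ((y - 0 : ℝ) : ℂ)) = Complex.exp (α * y) := by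
        congr 1; push_cast; ring
      rw [e1] at h
      refine h.trans ?_
      simp only [Complex.ofReal_re]
      gcongr
      exact BCF.norm_mk_le (bound_nonneg hM) _
    calc ‖(1 / 2 : ℂ) * (-(Complex.exp (-(α * y)) * jostJ₂ (α : ℂ) 0 ψ (-y)) +
          Complex.exp (α * y) * jostJ₂ (α : ℂ) 0 χ y)‖
        ≤ ‖(1 / 2 : ℂ)‖ * (‖Complex.exp (-(α * y)) * jostJ₂ (α : ℂ) 0 ψ (-y)‖ +
            ‖Complex.exp (α * y) * jostJ₂ (α : ℂ) 0 χ y‖) := by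
          rw [norm_mul]; gcongr; exact (norm_add_le _ _).trans (by rw [norm_neg])
      _ ≤ (1 / 2) * (M / α + M / α) := by
          rw [show ‖(1 / 2 : ℂ)‖ = 1 / 2 by simp]; gcongr
      _ = M / α := by ring

/-- **Sup bound of the Green potential**: `‖T y‖ ≤ M/α²`. [folklore] -/
theorem green_norm_le (hα : 0 < α) (hφ : Continuous φ) (hM : ∀ s, ‖φ s‖ ≤ M)
    (hT : T = fun y => (2 * (α : ℂ))⁻¹ * ∫ s, ((Real.exp (-(α * |y - s|)) : ℝ) : ℂ) * φ s) (y : ℝ) :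
    ‖T y‖ ≤ M / α ^ 2 := by
  have hre : 0 < ((α : ℂ)).re := by simpa using hα
  set ψ := BCF.mk (fun s => φ (-s)) (continuous_refl hφ) M (bound_refl hM) with hψ
  set χ := BCF.mk φ hφ M hM with hχ
  have h1 : ‖Complex.exp (-(α * y)) * jostJ₂ (α : ℂ) 0 ψ (-y)‖ ≤ M / α := by
    have h := norm_exp_mul_jostJ₂_le hre 0 ψ (-y)
    have e1 : Complex.exp ((α : ℂ) * (((-y) - 0 : ℝ) : ℂ)) = Complex.exp (-(α * y)) := by
      congr 1; push_cast; ring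
    rw [e1] at h
    refine h.trans ?_
    simp only [Complex.ofReal_re]
    gcongr
    exact BCF.norm_mk_le (bound_nonneg hM) _
  have h2 : ‖Complex.exp (α * y) * jostJ₂ (α : ℂ) 0 χ y‖ ≤ M / α := by
    have h := norm_exp_mul_jostJ₂_le hre 0 χ y
    have e1 : Complex.exp ((α : ℂ) * ((y - 0 : ℝ) : ℂ)) = Complex.exp (α * y) := by
      congr 1; push_cast; ring
    rw [e1] at h
    refine h.trans ?_
    simp only [Complex.ofReal_re]
    gcongr
    exact BCF.norm_mk_le (bound_nonneg hM) _
  rw [hT]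
  dsimp only
  rw [integral_kernel_mul_eq_split hα hφ hM, norm_mul, norm_inv, Complex.norm_mul, Complex.norm_real,
    Real.norm_of_nonneg hα.le, Complex.norm_two]
  calc (2 * α)⁻¹ * ‖Complex.exp (-(α * y)) * jostJ₂ (α : ℂ) 0 ψ (-y) + Complex.exp (α * y) * jostJ₂ (α : ℂ) 0 χ y‖
      ≤ (2 * α)⁻¹ * (M / α + M / α) := by
        gcongr
        exact (norm_add_le _ _).trans (add_le_add h1 h2)
    _ = M / α ^ 2 := by field_simp; ring

/-- **`L¹` bound of the Green potential**: `‖T y‖ ≤ (2α)⁻¹ ∫ ‖φ‖`. [folklore] -/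
theorem green_norm_le_integral (hα : 0 < α) (hint : Integrable φ)
    (hT : T = fun y => (2 * (α : ℂ))⁻¹ * ∫ s, ((Real.exp (-(α * |y - s|)) : ℝ) : ℂ) * φ s) (y : ℝ) :
    ‖T y‖ ≤ (2 * α)⁻¹ * ∫ s, ‖φ s‖ := by
  rw [hT]
  dsimp only
  rw [norm_mul, norm_inv, Complex.norm_mul, Complex.norm_real, Real.norm_of_nonneg hα.le, Complex.norm_two]
  gcongr
  refine norm_integral_le_of_norm_le hint.norm (Eventually.of_forall fun s => ?_)
  rw [norm_mul, norm_kernel]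
  exact mul_le_of_le_one_left (norm_nonneg _) (kernel_le_one hα.le y s)

/-- **The Green potential of an odd function is odd.** [folklore] -/
theorem green_odd (hodd : ∀ s, φ (-s) = -φ s)
    (hT : T = fun y => (2 * (α : ℂ))⁻¹ * ∫ s, ((Real.exp (-(α * |y - s|)) : ℝ) : ℂ) * φ s) (y : ℝ) :
    T (-y) = -T y := by
  rw [hT]
  dsimp only
  rw [← mul_neg, ← integral_neg]
  congr 1
  rw [← integral_neg_eq_self _ volume]
  refine integral_congr_ae (Eventually.of_forall fun s => ?_)
  dsimp only
  rw [hodd, mul_neg, show -y - -s = -(y - s) by ring, abs_neg]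

/-- **Linearity of the Green potential** (for bounded continuous data). [folklore] -/
theorem green_linear (hα : 0 < α) {φ₁ φ₂ : ℝ → ℂ} {M₁ M₂ : ℝ} (h₁ : Continuous φ₁) (hM₁ : ∀ s, ‖φ₁ s‖ ≤ M₁)
    (h₂ : Continuous φ₂) (hM₂ : ∀ s, ‖φ₂ s‖ ≤ M₂) (a b : ℂ) (y : ℝ) :
    (2 * (α : ℂ))⁻¹ * ∫ s, ((Real.exp (-(α * |y - s|)) : ℝ) : ℂ) * (a * φ₁ s + b * φ₂ s) =
      a * ((2 * (α : ℂ))⁻¹ * ∫ s, ((Real.exp (-(α * |y - s|)) : ℝ) : ℂ) * φ₁ s) +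
        b * ((2 * (α : ℂ))⁻¹ * ∫ s, ((Real.exp (-(α * |y - s|)) : ℝ) : ℂ) * φ₂ s) := by
  have i₁ := integrable_kernel_mul hα h₁ hM₁ y
  have i₂ := integrable_kernel_mul hα h₂ hM₂ y
  have hsplit : (fun s => ((Real.exp (-(α * |y - s|)) : ℝ) : ℂ) * (a * φ₁ s + b * φ₂ s)) =
      fun s => a * (((Real.exp (-(α * |y - s|)) : ℝ) : ℂ) * φ₁ s) + b * (((Real.exp (-(α * |y - s|)) : ℝ) : ℂ) * φ₂ s) := by
    funext s; ring
  rw [hsplit, integral_add (i₁.const_mul a) (i₂.const_mul b), integral_const_mul, integral_const_mul]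
  ring

/-- The Green potential is continuous. [folklore] -/
theorem green_continuous (hα : 0 < α) (hφ : Continuous φ) (hM : ∀ s, ‖φ s‖ ≤ M)
    (hT : T = fun y => (2 * (α : ℂ))⁻¹ * ∫ s, ((Real.exp (-(α * |y - s|)) : ℝ) : ℂ) * φ s) :
    Continuous T := by
  obtain ⟨T', hT', -, -⟩ := green_hasDerivAt hα hφ hM hT
  exact continuous_iff_continuousAt.2 fun y => (hT' y).continuousAt

end Summit.AnomalousDissipation.AnomalousDissipation.Theorems.MarginalStabilityChainBurgersLayerLowRe
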